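import Summits.KontsevichZagierPeriods.KontsevichZagierPeriods.Theorems.HurwitzMicroSectorsNormalFormPrincipleL2W3MoebiusMove
import Summits.KontsevichZagierPeriods.KontsevichZagierPeriods.Theorems.HyperbolicBlochOffTetraSectorKernelStubAffineOrbit

/-!
# `NormalFormPrinciple` (stmt-KontsevichZagierPeriods-3869), line `SketchIdeator1` —
# leaf `stub_boxRigidity`, layer `L2W3` (level-2 weight-3 descent): Möbius relation package one

Pure proof file (registered sub-goal `l2w3_relations_moebius_one` of the layer `L2W3`, lead seat
c9; `--supports` the crux). Letters on `(0,1)`: `a(u) = 1/u`, `b(u) = 1/(1 − u)`,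
`c(u) = 1/(1 + u)`. On the decreasing open simplex `Δ = {t | 0 < t₂ < t₁ < t₀ < 1} ⊆ ℝ³` the
*word representation* `[x y z] = [Δ, x(t₀) y(t₁) z(t₂)]` is the iterated integral `∫ x y z` over
`1 > t₀ > t₁ > t₂ > 0`. The MÖBIUS INVOLUTION `σ(u) = (1 − u)/(1 + u)` of `(0,1)`, applied to all
three coordinates with order reversal, is ONE change of variables of the Kontsevich–Zagier
calculus (rule (2); the landed move `l2w3_moebius_move`, which also supplies the pulled-back
carrier). Together with the Jacobian factor `|σ'(u)| = 2/(1 + u)²` it pulls the letters back as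

  `a(σu)·2/(1+u)² = b(u) + c(u)`,  `b(σu)·2/(1+u)² = a(u) − c(u)`,  `c(σu)·2/(1+u)² = c(u)`

(`l2n_moebius_letter_pulls`). Expanding the pulled-back integrand into words by integrand
additivity on the common domain `Δ` (iterated rule (1b),
`aff_orbit_of_sub_sum_zsmul_mem_relations`) gives the two relations of this package:

* (rel3) the word `a a c` pulls back to `c·(b + c)·(b + c) = cbb + cbc + ccb + ccc`, whence
  `[cbb] + [cbc] + [ccb] + [ccc] − [aac] ∈ KZ.relations`;
* (rel4) the word `a a b` pulls back to `(a − c)·(b + c)·(b + c)`, whence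
  `[abb] + [abc] + [acb] + [acc] − [cbb] − [cbc] − [ccb] − [ccc] − [aab] ∈ KZ.relations`.

The carriers are arbitrary representations on `Δ` with the displayed integrands (hypotheses of
the registered statement `l2w3_relations_moebius_one`, kept in its `∀` form: the proof introduces
them). Each relation is ONE rule-(2) move plus rule-(1b) bookkeeping in the free abelian group
`KZ.FormalRep`.

References: M. Kontsevich, D. Zagier, *Periods* (2001), §1.1–1.2, rules (1b), (2); J. Zhao,
*Multiple polylogarithm values at roots of unity*, C. R. Acad. Sci. Paris 346 (2008), §4 (the
involution `σ`). No definitions are introduced.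
-/

noncomputable section

open MeasureTheory Set
open Literature.NumberTheory.Transcendental Literature.NumberTheory.Transcendental.KZ
open Literature.ModelTheory.ExponentialFields (IsSemialgebraic)
open Summit.KontsevichZagierPeriods.HyperbolicBloch.OffTetraSectorKernel
  (aff_orbit_of_sub_sum_zsmul_mem_relations)

namespace Summit.KontsevichZagierPeriods.HurwitzMicroSectors.NormalFormPrinciple.PiBox.M3

/-! ## The Möbius pull-backs of the three letters -/

/-- **Möbius pull-backs of the letters `a`, `b`, `c`.** For `0 < u < 1` and
`σ(u) = (1 − u)/(1 + u)` (Jacobian factor `|σ'(u)| = 2/(1 + u)²`):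
`a(σu)·2/(1+u)² = b(u) + c(u)`, `b(σu)·2/(1+u)² = a(u) − c(u)` and `c(σu)·2/(1+u)² = c(u)`,
where `a(u) = 1/u`, `b(u) = 1/(1 − u)`, `c(u) = 1/(1 + u)`. [folklore] -/
theorem l2n_moebius_letter_pulls {u : ℝ} (h0 : 0 < u) (h1 : u < 1) :
    1 / ((1 - u) / (1 + u)) * (2 / (1 + u) ^ 2) = 1 / (1 - u) + 1 / (1 + u) ∧
    1 / (1 - (1 - u) / (1 + u)) * (2 / (1 + u) ^ 2) = 1 / u - 1 / (1 + u) ∧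
    1 / (1 + (1 - u) / (1 + u)) * (2 / (1 + u) ^ 2) = 1 / (1 + u) := by
  have hp : (1:ℝ) + u ≠ 0 := by linarith
  have hm : (1:ℝ) - u ≠ 0 := by linarith
  have hu : u ≠ 0 := h0.ne'
  refine ⟨?_, ?_, ?_⟩
  · field_simp
    ring
  · have h3 : 1 - (1 - u) / (1 + u) = 2 * u / (1 + u) := by
      field_simp
      ring
    rw [h3]
    field_simp
    ring
  · have h3 : 1 + (1 - u) / (1 + u) = 2 / (1 + u) := by
      field_simp
      ring
    rw [h3]
    field_simp

/-! ## The registered relation package -/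

/-- **Möbius relation package one (rel3, rel4)** among the weight-3 level-2 word representations
on the decreasing open simplex `Δ = {0 < t₂ < t₁ < t₀ < 1}` (letters `a(u) = 1/u`,
`b(u) = 1/(1 − u)`, `c(u) = 1/(1 + u)`; carriers given as hypotheses), each ONE Möbius move
`t ↦ (σt₂, σt₁, σt₀)`, `σ(u) = (1 − u)/(1 + u)` (rule (2), `l2w3_moebius_move`) followed by
integrand additivity on `Δ` (rule (1b), `aff_orbit_of_sub_sum_zsmul_mem_relations`):
(rel3) the Möbius move carries `[AAC]` to the representation `N` on `Δ` with integrand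
`c(σt₀)J(t₀) · a(σt₁)J(t₁) · a(σt₂)J(t₂) = c(t₀) (b + c)(t₁) (b + c)(t₂)`, and
`[N] = [CBB] + [CBC] + [CCB] + [CCC]`, whence `[CBB] + [CBC] + [CCB] + [CCC] − [AAC] ∈ KZ.relations`;
(rel4) it carries `[AAB]` to `N` with integrand
`b(σt₀)J(t₀) · a(σt₁)J(t₁) · a(σt₂)J(t₂) = (a − c)(t₀) (b + c)(t₁) (b + c)(t₂)`, and
`[N] = [ABB] + [ABC] + [ACB] + [ACC] − [CBB] − [CBC] − [CCB] − [CCC]`, whence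
`[ABB] + [ABC] + [ACB] + [ACC] − [CBB] − [CBC] − [CCB] − [CCC] − [AAB] ∈ KZ.relations`.
[cite: KontsevichZagier2001, §1.2 rule (2)] -/
theorem l2w3_relations_moebius_one :
    (∀ (AAC : IntegralRep 3), AAC.domain = {t | 0 < t 2 ∧ t 2 < t 1 ∧ t 1 < t 0 ∧ t 0 < 1} →
        (AAC.integrand = fun t => 1 / t 0 * 1 / t 1 * (1 / (1 + t 2))) →
      ∀ (CBB : IntegralRep 3), CBB.domain = {t | 0 < t 2 ∧ t 2 < t 1 ∧ t 1 < t 0 ∧ t 0 < 1} →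
        (CBB.integrand = fun t => 1 / (1 + t 0) * (1 / (1 - t 1)) * (1 / (1 - t 2))) →
      ∀ (CBC : IntegralRep 3), CBC.domain = {t | 0 < t 2 ∧ t 2 < t 1 ∧ t 1 < t 0 ∧ t 0 < 1} →
        (CBC.integrand = fun t => 1 / (1 + t 0) * (1 / (1 - t 1)) * (1 / (1 + t 2))) →
      ∀ (CCB : IntegralRep 3), CCB.domain = {t | 0 < t 2 ∧ t 2 < t 1 ∧ t 1 < t 0 ∧ t 0 < 1} →
        (CCB.integrand = fun t => 1 / (1 + t 0) * (1 / (1 + t 1)) * (1 / (1 - t 2))) →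
      ∀ (CCC : IntegralRep 3), CCC.domain = {t | 0 < t 2 ∧ t 2 < t 1 ∧ t 1 < t 0 ∧ t 0 < 1} →
        (CCC.integrand = fun t => 1 / (1 + t 0) * (1 / (1 + t 1)) * (1 / (1 + t 2))) →
        of CBB + of CBC + of CCB + of CCC - of AAC ∈ relations) ∧
    (∀ (AAB : IntegralRep 3), AAB.domain = {t | 0 < t 2 ∧ t 2 < t 1 ∧ t 1 < t 0 ∧ t 0 < 1} →
        (AAB.integrand = fun t => 1 / t 0 * 1 / t 1 * (1 / (1 - t 2))) →
      ∀ (ABB : IntegralRep 3), ABB.domain = {t | 0 < t 2 ∧ t 2 < t 1 ∧ t 1 < t 0 ∧ t 0 < 1} →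
        (ABB.integrand = fun t => 1 / t 0 * (1 / (1 - t 1)) * (1 / (1 - t 2))) →
      ∀ (ABC : IntegralRep 3), ABC.domain = {t | 0 < t 2 ∧ t 2 < t 1 ∧ t 1 < t 0 ∧ t 0 < 1} →
        (ABC.integrand = fun t => 1 / t 0 * (1 / (1 - t 1)) * (1 / (1 + t 2))) →
      ∀ (ACB : IntegralRep 3), ACB.domain = {t | 0 < t 2 ∧ t 2 < t 1 ∧ t 1 < t 0 ∧ t 0 < 1} →
        (ACB.integrand = fun t => 1 / t 0 * (1 / (1 + t 1)) * (1 / (1 - t 2))) →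
      ∀ (ACC : IntegralRep 3), ACC.domain = {t | 0 < t 2 ∧ t 2 < t 1 ∧ t 1 < t 0 ∧ t 0 < 1} →
        (ACC.integrand = fun t => 1 / t 0 * (1 / (1 + t 1)) * (1 / (1 + t 2))) →
      ∀ (CBB : IntegralRep 3), CBB.domain = {t | 0 < t 2 ∧ t 2 < t 1 ∧ t 1 < t 0 ∧ t 0 < 1} →
        (CBB.integrand = fun t => 1 / (1 + t 0) * (1 / (1 - t 1)) * (1 / (1 - t 2))) →
      ∀ (CBC : IntegralRep 3), CBC.domain = {t | 0 < t 2 ∧ t 2 < t 1 ∧ t 1 < t 0 ∧ t 0 < 1} →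
        (CBC.integrand = fun t => 1 / (1 + t 0) * (1 / (1 - t 1)) * (1 / (1 + t 2))) →
      ∀ (CCB : IntegralRep 3), CCB.domain = {t | 0 < t 2 ∧ t 2 < t 1 ∧ t 1 < t 0 ∧ t 0 < 1} →
        (CCB.integrand = fun t => 1 / (1 + t 0) * (1 / (1 + t 1)) * (1 / (1 - t 2))) →
      ∀ (CCC : IntegralRep 3), CCC.domain = {t | 0 < t 2 ∧ t 2 < t 1 ∧ t 1 < t 0 ∧ t 0 < 1} →
        (CCC.integrand = fun t => 1 / (1 + t 0) * (1 / (1 + t 1)) * (1 / (1 + t 2))) →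
        of ABB + of ABC + of ACB + of ACC - of CBB - of CBC - of CCB - of CCC - of AAB ∈ relations) := by
  refine ⟨?_, ?_⟩
  · -- (rel3) the Möbius move on the word `a a c`
    intro AAC hAACd hAACi CBB hCBBd hCBBi CBC hCBCd hCBCi CCB hCCBd hCCBi CCC hCCCd hCCCi
    -- the word `a a c` carried by `AAC`, in the form consumed by the move
    have hTi : EqOn AAC.integrand (fun t => (fun u : ℝ => 1 / u) (t 0) *
        (fun u : ℝ => 1 / u) (t 1) * (fun u : ℝ => 1 / (1 + u)) (t 2)) AAC.domain := fun t _ => by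
      simp only [hAACi]
      ring
    -- ONE Möbius move (rule (2)) and its pulled-back carrier `N`
    obtain ⟨hmove, N, hNd, hNi⟩ := l2w3_moebius_move (fun u => 1 / u) (fun u => 1 / u)
      (fun u => 1 / (1 + u)) AAC hAACd hTi
    have m1 : of N - of AAC ∈ relations := hmove N hNd (hNi ▸ fun _ _ => rfl)
    -- rule (1b) on `Δ`: `[N] = [CBB] + [CBC] + [CCB] + [CCC]`
    have m2 : of N - ((1:ℤ) • of CBB + (1:ℤ) • of CBC + (1:ℤ) • of CCB + (1:ℤ) • of CCC) ∈
        relations := by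
      have h := aff_orbit_of_sub_sum_zsmul_mem_relations (Finset.univ : Finset (Fin 4))
        ![CBB, CBC, CCB, CCC] ![1, 1, 1, 1] N (fun i _ => by
          fin_cases i
          · exact hCBBd.trans hNd.symm
          · exact hCBCd.trans hNd.symm
          · exact hCCBd.trans hNd.symm
          · exact hCCCd.trans hNd.symm) fun t ht => ?_
      · simpa [Fin.sum_univ_four, add_assoc] using h
      rw [hNd] at ht
      obtain ⟨h2, h21, h10, h01⟩ := ht
      rw [hNi]
      simp only [Fin.sum_univ_four, Matrix.cons_val_zero, Matrix.cons_val_one, Matrix.cons_val_two,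
        Matrix.cons_val_three, Matrix.head_cons, Matrix.tail_cons, hCBBi, hCBCi, hCCBi, hCCCi]
      rw [(l2n_moebius_letter_pulls (h2.trans (h21.trans h10)) h01).2.2,
        (l2n_moebius_letter_pulls (h2.trans h21) (h10.trans h01)).1,
        (l2n_moebius_letter_pulls h2 ((h21.trans h10).trans h01)).1]
      push_cast
      ring
    -- bookkeeping in the free abelian group
    have e : of CBB + of CBC + of CCB + of CCC - of AAC =
        (of N - of AAC) -
          (of N - ((1:ℤ) • of CBB + (1:ℤ) • of CBC + (1:ℤ) • of CCB + (1:ℤ) • of CCC)) := by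
      simp only [one_smul]
      abel
    rw [e]
    exact relations.sub_mem m1 m2
  · -- (rel4) the Möbius move on the word `a a b`
    intro AAB hAABd hAABi ABB hABBd hABBi ABC hABCd hABCi ACB hACBd hACBi ACC hACCd hACCi
      CBB hCBBd hCBBi CBC hCBCd hCBCi CCB hCCBd hCCBi CCC hCCCd hCCCi
    -- the word `a a b` carried by `AAB`, in the form consumed by the move
    have hTi : EqOn AAB.integrand (fun t => (fun u : ℝ => 1 / u) (t 0) *
        (fun u : ℝ => 1 / u) (t 1) * (fun u : ℝ => 1 / (1 - u)) (t 2)) AAB.domain := fun t _ => by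
      simp only [hAABi]
      ring
    -- ONE Möbius move (rule (2)) and its pulled-back carrier `N`
    obtain ⟨hmove, N, hNd, hNi⟩ := l2w3_moebius_move (fun u => 1 / u) (fun u => 1 / u)
      (fun u => 1 / (1 - u)) AAB hAABd hTi
    have m1 : of N - of AAB ∈ relations := hmove N hNd (hNi ▸ fun _ _ => rfl)
    -- rule (1b) on `Δ`: `[N] = [ABB] + [ABC] + [ACB] + [ACC] − [CBB] − [CBC] − [CCB] − [CCC]`
    have m2 : of N - ((1:ℤ) • of ABB + (1:ℤ) • of ABC + (1:ℤ) • of ACB + (1:ℤ) • of ACC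
        + (-1:ℤ) • of CBB + (-1:ℤ) • of CBC + (-1:ℤ) • of CCB + (-1:ℤ) • of CCC) ∈ relations := by
      have h := aff_orbit_of_sub_sum_zsmul_mem_relations (Finset.univ : Finset (Fin 8))
        ![ABB, ABC, ACB, ACC, CBB, CBC, CCB, CCC] ![1, 1, 1, 1, -1, -1, -1, -1] N (fun i _ => by
          fin_cases i
          · exact hABBd.trans hNd.symm
          · exact hABCd.trans hNd.symm
          · exact hACBd.trans hNd.symm
          · exact hACCd.trans hNd.symm
          · exact hCBBd.trans hNd.symm
          · exact hCBCd.trans hNd.symm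
          · exact hCCBd.trans hNd.symm
          · exact hCCCd.trans hNd.symm) fun t ht => ?_
      · simpa [Fin.sum_univ_eight, add_assoc] using h
      rw [hNd] at ht
      obtain ⟨h2, h21, h10, h01⟩ := ht
      rw [hNi]
      have hs : ∀ t : Fin 3 → ℝ,
          (∑ i : Fin 8, ((![1, 1, 1, 1, -1, -1, -1, -1] : Fin 8 → ℤ) i : ℝ) *
            ((![ABB, ABC, ACB, ACC, CBB, CBC, CCB, CCC] : Fin 8 → IntegralRep 3) i).integrand t) =
          ABB.integrand t + ABC.integrand t + ACB.integrand t + ACC.integrand t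
            - CBB.integrand t - CBC.integrand t - CCB.integrand t - CCC.integrand t := fun t => by
        simp [Fin.sum_univ_eight]
        ring
      simp only [hs]
      simp only [hABBi, hABCi, hACBi, hACCi, hCBBi, hCBCi, hCCBi, hCCCi]
      rw [(l2n_moebius_letter_pulls (h2.trans (h21.trans h10)) h01).2.1,
        (l2n_moebius_letter_pulls (h2.trans h21) (h10.trans h01)).1,
        (l2n_moebius_letter_pulls h2 ((h21.trans h10).trans h01)).1]
      ring
    -- bookkeeping in the free abelian group
    have e : of ABB + of ABC + of ACB + of ACC - of CBB - of CBC - of CCB - of CCC - of AAB =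
        (of N - of AAB) - (of N - ((1:ℤ) • of ABB + (1:ℤ) • of ABC + (1:ℤ) • of ACB +
          (1:ℤ) • of ACC + (-1:ℤ) • of CBB + (-1:ℤ) • of CBC + (-1:ℤ) • of CCB +
          (-1:ℤ) • of CCC)) := by
      simp only [one_smul, neg_smul]
      abel
    rw [e]
    exact relations.sub_mem m1 m2

end Summit.KontsevichZagierPeriods.HurwitzMicroSectors.NormalFormPrinciple.PiBox.M3
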